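import Literature.NumberTheory.EllipticCurves.FineSelmerIsotypicClassGroupCriterion
import Literature.NumberTheory.EllipticCurves.AnticyclotomicPrimeDecompositionAboveProofs
import Literature.NumberTheory.EllipticCurves.BSDSelmerPConverseSerreProofs
import Literature.NumberTheory.EllipticCurves.SupersingularIrreducibleProofs
import Literature.NumberTheory.EllipticCurves.IrreducibleModPQuadraticTwistProofs
import Summits.BirchSwinnertonDyer.Rank1Residual.GaloisImage.SupersingularTwistInertiaOrder
import Summits.BirchSwinnertonDyer.BirchSwinnertonDyer.Theorems.AdditiveBranchIMCGordTwoRankOneSmallImageDickson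
import Summits.BirchSwinnertonDyer.Rank1Residual.Additive.QuadraticBranchPlusEtaNodes
import Summits.BirchSwinnertonDyer.Rank1Residual.Additive.GordDescent
import HarnessLib

/-!
# Route `QuadraticBranchSignedControl` (rung K8, cell `bsd-potss`), residual crux `PlusEtaMainConjectureNonsurj`
# (stmt-BirchSwinnertonDyer-19606): DOOR L6 ON THE ROWS AND THEIR ADDITIVE PARTNERS — Coates–Sujatha's statement (A)
# from ONE class-group datum, with the door's inputs (c1) and (c3) PROVED on every row (seat `bsd-potss-k8eta-c2` g20)

WHAT. Door L6 (literature seat `bsd-potss-conjA-anchor` g17, `CoatesSujatha2005.conjA_of_homTrivial_divisionField`, with the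
entries `conjA_of_not_dvd_card_classGroup` / `conjA_of_eigenHom_subfield`; `E[p]`-isotypic Coates–Sujatha 2005 Thm. 3.4 proved
WITHOUT `H²`/Poitou–Tate, NO named fact) gives statement (A) — the dual fine Selmer group of `E` over `ℚ_cyc` is finitely generated
over `ℤ_p`, the tree's `∃ γ D, Module.Finite ℤ_[p] D.X` — from three per-curve inputs: (c1) `p ∤ #Gal(ℚ(E[p])/ℚ)`, (c2*)₀ a
class-group datum (`Hom_{Γ_ℚ}(Cl(𝓞_{ℚ(E[p])}), E[p]) = 0`, or `p ∤ #Cl(𝓞_{ℚ(E[p])})`, or the eigen-test on `Cl(ℚ(P))`), (c3) no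
non-zero `p`-torsion fixed by `D_p`. This file proves that on the rows of crux 19606 the inputs (c1) and (c3) are AUTOMATIC, for the
row `V` (globally minimal, `p ≥ 5` good, `a_p(V) = 0`, `p`-adic tower NOT onto) AND for its additive partner `W` (`C • W^{(p*)} = V`, the
curve whose statement (A) v7's stub `stub_conjA_partners_cm` asks for):
* §0 generic: an element of `I_{𝔓₀} ≤ D_v` acting as `−1` on `E[p]` kills every `D_v`-fixed `p`-torsion point (`p` odd), in the
  torsion currency and in the `E[p^∞]`-currency; a homomorphism from a finite group of order prime to `p` to `ZMod p` is zero.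
* §1 the row: `¬ Surj` (Serre's lifting lemma, tree `serre_hasSurjectiveModNGaloisRep_pow_holds`), `V[p]` irreducible (Serre Prop. 12,
  tree), hence (c1) by the tree's Prop. 15 (`SmallImageDickson.not_dvd_card_aut_divisionField`); (c3) from the inertial `−1` at a good
  supersingular odd prime (`exists_mem_inertia_smul_eq_neg_of_goodSS`).
* §2 the partner: ONE inertial `z` acts as `−1` on BOTH `W[p]` and `V[p]` (`exists_mem_inertia_smul_eq_neg_of_goodSS_twist`) ⟹ (c3)
  for `W`; the signed twisting isomorphism `W[p] ≃+ V[p]` transports the image (`card_map_galoisRepTorsion_eq_of_signed_addEquiv` at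
  `H = ⊤`): `#Gal(ℚ(W[p])/ℚ) = #Gal(ℚ(V[p])/ℚ)` ⟹ (c1) for `W`; `W[p]` irreducible.
* §3 statement (A) on the row / on the partner from ONE class-group datum in each of the three currencies, in particular
  `conjA_partner_of_not_dvd_classNumber_stabilizerField`: **(A)(W, p) ⟸ `p ∤ h(ℚ(P))` for one `P ∈ W[p] ∖ 0`** (`[ℚ(P):ℚ] = p² − 1`), via
  the curve-generic `conjA_of_not_dvd_classNumber_stabilizerField` = the FACT-FREE twin of conjA-anchor g8's
  `DeoRaySujatha2023.thm39_of_homTrivial_of_classNumber_stabilizerField` (its Deo–Ray–Sujatha Thm. 3.9 binder replaced by door L6; the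
  door's eigen-test is empty when `p ∤ h`). So every displayed `hA'` / `hloc` of the cell's fine-road records is ONE class number away
  from the kernel, with no `hS28`, no congruence transfer, no analytic `Ш`, no generator.

SCOPE (numbers, not adjectives). (c2*)₀ is SUFFICIENT, not necessary: for a CM partner `W` it says `Sel₀(ℚ, W[p]) = 0` (the everywhere-
unramified classes over `ℚ(W[p])` are exactly the classes locally trivial at `p` — the inertia image has order `p² − 1` prime to `p` — and
at the additive primes), so the door is VOID on exactly the rows where Deo–Ray–Sujatha's `H²`-criterion is void: k8eta-c2 g7's 17 residual
CM rows (generator `P ∈ pW(ℚ_p)`, `Ш¹_S(ℚ, W[p]) ≠ 0`) stay on g7's layer-`n` criterion. NOT a candidate stub: the class-wide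
statement «(c2*)₀ on every partner» is false (it fails whenever `Sel₀(ℚ, W[p]) ≠ 0`, e.g. `rank W(ℚ) ≥ 2`); this is a PER-ROW road.

HONEST FRAMING (cell `bsd-potss`; FULL-BSD rank ≤ 1 programme, HUMAN RULING D-0036/D-0074): TOOL THEOREMS ONLY — no definition, no named
fact, no `sorry`, axioms standard; every theorem PROVED (the class-group datum is a hypothesis). No stub of 19606 is proved by name; the
crux stays OPEN; nothing is booked; (A) and `BSD(W,p)` are claimed for no pair. `--supports stmt-BirchSwinnertonDyer-19606 --as helper`.

References: [CoatesSujatha2005] §3 Conjecture A, Thm. 3.4, Lemma 3.8, Cor. 3.6; [DeoRaySujatha2023] Thm. 3.8 (c1)–(c3), Thm. 3.9 (b);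
[Serre1972] §1.11 Prop. 12, §2.4 Prop. 15; [SerreAbelianLadic1968] IV §3.4 Lemma 3; [SilvermanAEC2009] X.5 Cor. 5.4;
[NeukirchANT1999] II §9 Prop. (9.6), III §1 Prop. (1.6) (iv).
-/

set_option autoImplicit false
-- sibling precedent (`KatoDescentPotSupersingularAssembly.lean`): the directory name repeats the summit name
set_option linter.dupNamespace false
noncomputable section

open scoped Classical

open NumberField IsDedekindDomain Field WeierstrassCurve
open Literature.NumberTheory.EllipticCurves Literature.NumberTheory.GaloisRepresentations
  Literature.NumberTheory.EllipticCurves.Rank1Residual Literature.NumberTheory.NumberFields Rat.HeightOneSpectrum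
open Literature.NumberTheory.EllipticCurves.GreenbergSelmer (decomp)
open Literature.NumberTheory.EllipticCurves.CoatesSujatha2005
open Summit.BirchSwinnertonDyer.Rank1Residual Summit.BirchSwinnertonDyer.Rank1Residual.GaloisImage
  Summit.BirchSwinnertonDyer.BirchSwinnertonDyer.Theorems.AdditiveBranchIMCGordTwoRankOne

namespace Summit.BirchSwinnertonDyer.BirchSwinnertonDyer.Theorems.EtaConjADoor

variable (V : WeierstrassCurve ℚ) (p : ℕ) [hp : Fact p.Prime]

/-! ## §0 Two generic lemmas: an inertial `−1` kills the `D_v`-fixed `p`-torsion (`p` odd) -/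

/-- **From an inertial `−1` to (c3), torsion currency**: if some `z ∈ I_{𝔓₀}` (`𝔓₀ = adicCompletionPrime ℚ v`, the prime
of the chosen embedding above the place `v`) acts as `−1` on `V[p]`, `p ≠ 2`, then no non-zero point of `V[p]` is fixed
by the decomposition group `D_v` (`I_{𝔓₀} ≤ D_v`, tree `ZpExtension.inertia_adicCompletionPrime_le_decomp`; `x = z•x = −x`
forces `2x = 0`, and `px = 0`). [cite: NeukirchANT1999, Ch. II §9 Prop. (9.6)] -/
theorem geomTorsion_fixed_eq_zero_of_smul_eq_neg (hp2 : p ≠ 2) (v : HeightOneSpectrum (𝓞 ℚ))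
    {z : absoluteGaloisGroup ℚ} (hz : z ∈ (adicCompletionPrime ℚ v).inertia (absoluteGaloisGroup ℚ))
    (hneg : ∀ P : geomTorsion V (p : ℤ), z • P = -P)
    (x : geomTorsion V (p : ℤ)) (hx : ∀ d ∈ decomp v, d • x = x) : x = 0 := by
  have h1 : x = -x := by rw [← hneg x, hx z (ZpExtension.inertia_adicCompletionPrime_le_decomp v hz)]
  have h2 : (2 : ℕ) • x = 0 := by rw [two_nsmul]; nth_rewrite 2 [h1]; exact add_neg_cancel x
  have hpx : p • x = 0 := by
    apply Subtype.ext
    have hv : ((x : geomTorsion V (p : ℤ)) : geomPoints V) ∈ AddSubgroup.torsionBy (geomPoints V) (p : ℤ) := x.2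
    rw [AddSubgroup.torsionBy, Submodule.mem_toAddSubgroup, Submodule.mem_torsionBy_iff] at hv
    rw [AddSubgroupClass.coe_nsmul, ZeroMemClass.coe_zero, ← natCast_zsmul]
    exact hv
  have hcop : (2 : ℕ).Coprime p := (Nat.coprime_primes Nat.prime_two hp.out).2 (Ne.symm hp2)
  obtain ⟨a, b, hab⟩ : ∃ a b : ℤ, a * 2 + b * p = 1 := by
    obtain ⟨a, b, h⟩ := Nat.isCoprime_iff_coprime.mpr hcop
    exact ⟨a, b, by simpa using h⟩
  have : (1 : ℤ) • x = 0 := by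
    rw [← hab, add_smul, mul_smul, mul_smul, show (2 : ℤ) • x = (2 : ℕ) • x from by norm_cast, h2, smul_zero,
      show (p : ℤ) • x = (p : ℕ) • x from natCast_zsmul x p, hpx, smul_zero, add_zero]
  simpa using this

omit hp in
/-- **Currency conversion, torsion ⟹ `E[p^∞]`** (converse of the tree's `geomTorsion_fixed_eq_zero_of_geomPrimaryTorsion`): if no
non-zero point of `V[p]` is `D_v`-fixed, then no non-zero `x ∈ V[p^∞]` with `px = 0` is `D_v`-fixed (such an `x` IS a point of `V[p]`;
the hypothesis shape of `CoatesSujatha2005.conjA_of_not_dvd_card_classGroup` / `conjA_of_eigenHom_subfield`). [folklore] -/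
theorem geomTorsion_fixed_eq_zero_of_geomPrimaryTorsion' (v : HeightOneSpectrum (𝓞 ℚ))
    (h : ∀ x : geomTorsion V (p : ℤ), (∀ d ∈ decomp v, d • x = x) → x = 0)
    (x : V.geomPrimaryTorsion p) (hpx : p • x = 0) (hx : ∀ d ∈ decomp v, d • x = x) : x = 0 := by
  have hxT : (x : geomPoints V) ∈ geomTorsion V (p : ℤ) := by
    have h := congrArg (fun y : V.geomPrimaryTorsion p => (y : geomPoints V)) hpx
    simp only [AddSubgroupClass.coe_nsmul, ZeroMemClass.coe_zero] at h
    show (x : geomPoints V) ∈ AddSubgroup.torsionBy (geomPoints V) (p : ℤ)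
    rw [AddSubgroup.torsionBy, Submodule.mem_toAddSubgroup, Submodule.mem_torsionBy_iff, natCast_zsmul]
    exact h
  have hy0 : (⟨x, hxT⟩ : geomTorsion V (p : ℤ)) = 0 :=
    h _ fun d hd => Subtype.ext (congrArg (fun t : V.geomPrimaryTorsion p => (t : geomPoints V)) (hx d hd))
  exact Subtype.ext (congrArg (fun t : geomTorsion V (p : ℤ) => (t : geomPoints V)) hy0)

/-- A homomorphism from a finite abelian group of order prime to `p` to `ZMod p` is zero. [folklore] -/
theorem addMonoidHom_zmod_eq_zero_of_not_dvd_card {G : Type*} [CommGroup G] [Finite G]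
    (hG : ¬ p ∣ Nat.card G) (μ : Additive G →+ ZMod p) : μ = 0 := by
  refine AddMonoidHom.ext fun a => ?_
  have ha : Nat.card G • a = 0 := by rw [← ofMul_toMul a, ← ofMul_pow, pow_card_eq_one', ofMul_one]
  have h1 : ((Nat.card G : ℕ) : ZMod p) * μ a = 0 := by rw [← nsmul_eq_mul, ← map_nsmul, ha, map_zero]
  have hunit : IsUnit ((Nat.card G : ℕ) : ZMod p) := by
    rw [ZMod.isUnit_iff_coprime]
    exact Nat.coprime_comm.mp ((Nat.Prime.coprime_iff_not_dvd hp.out).mpr hG)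
  exact (hunit.mul_right_eq_zero).mp h1

/-! ## §1 The row itself: (c1) and (c3) of door L6 are automatic -/

section Row

variable [V.IsElliptic] [V.IsGloballyMinimal]

omit [V.IsGloballyMinimal] in
/-- On a row of crux 19606 (`p ≥ 5`, tower not onto) the mod-`p` representation is NOT onto (Serre's lifting lemma, tree
`serre_hasSurjectiveModNGaloisRep_pow_holds`). [cite: SerreAbelianLadic1968, Ch. IV §3.4 Lemma 3] -/
theorem not_surj_of_row (hp5 : 5 ≤ p) (hns : ¬ ∀ m : ℕ, V.HasSurjectiveModNGaloisRep (p ^ m : ℕ)) :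
    ¬ V.HasSurjectiveModNGaloisRep p := fun h => hns (serre_hasSurjectiveModNGaloisRep_pow_holds V p hp5 h)

omit [V.IsElliptic] in
/-- On a row of crux 19606, `GoodSS V p` (good reduction and `p ∣ a_p`). [folklore] -/
theorem goodSS_of_row (hgood : V.HasGoodReductionAtPrime p) (hap : V.frobeniusTrace p = 0) : GoodSS V p :=
  ⟨hgood, by rw [hap]; exact dvd_zero _⟩
/-- On a row of crux 19606, `V[p]` is irreducible (Serre 1972 Prop. 12 at a good supersingular odd prime, tree
`hasIrreducibleModPGaloisRep_of_dvd_frobeniusTrace`). [cite: Serre1972, §1.11 Prop. 12] -/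
theorem irreducible_of_row (hp5 : 5 ≤ p) (hgood : V.HasGoodReductionAtPrime p) (hap : V.frobeniusTrace p = 0) :
    V.HasIrreducibleModPGaloisRep p :=
  hasIrreducibleModPGaloisRep_of_dvd_frobeniusTrace V p (by omega)
    (V.not_dvd_minimalDiscriminantInt_of_hasGoodReductionAtPrime' p hgood) (goodSS_of_row V p hgood hap).2

/-- **(c1) on a row**: `p ∤ #Gal(ℚ(V[p])/ℚ)` (irreducible + not onto ⟹ Serre's Prop. 15, tree
`SmallImageDickson.not_dvd_card_aut_divisionField`). [cite: Serre1972, §2.4 Prop. 15] -/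
theorem not_dvd_card_aut_divisionField_of_row [NeZero p] (hp5 : 5 ≤ p) (hgood : V.HasGoodReductionAtPrime p)
    (hap : V.frobeniusTrace p = 0) (hns : ¬ ∀ m : ℕ, V.HasSurjectiveModNGaloisRep (p ^ m : ℕ)) :
    ¬ p ∣ Nat.card (V.divisionField p ≃ₐ[ℚ] V.divisionField p) :=
  SmallImageDickson.not_dvd_card_aut_divisionField V p (irreducible_of_row V p hp5 hgood hap)
    (not_surj_of_row V p hp5 hns)

/-- **(c3) on a row, torsion currency**: at every place `v ∋ p`, no non-zero point of `V[p]` is fixed by `D_v` — a good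
supersingular odd prime has an inertial element acting as `−1` on `V[p]` (tree `exists_mem_inertia_smul_eq_neg_of_goodSS`).
[cite: Serre1972, §1.11 Prop. 12] -/
theorem geomTorsion_fixed_eq_zero_of_row (hp5 : 5 ≤ p) (hgood : V.HasGoodReductionAtPrime p)
    (hap : V.frobeniusTrace p = 0) (v : HeightOneSpectrum (𝓞 ℚ)) (hv : ((p : ℕ) : 𝓞 ℚ) ∈ v.asIdeal)
    (x : geomTorsion V (p : ℤ)) (hx : ∀ d ∈ decomp v, d • x = x) : x = 0 := by
  obtain ⟨z, hz, hneg⟩ := exists_mem_inertia_smul_eq_neg_of_goodSS (W := V) (p := p) (by omega)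
    (goodSS_of_row V p hgood hap) hv (adicCompletionPrime_mem_primesAbove ℚ v)
  exact geomTorsion_fixed_eq_zero_of_smul_eq_neg V p (by omega) v hz hneg x hx

/-- **(c3) on a row, `E[p^∞]`-currency.** [cite: Serre1972, §1.11 Prop. 12] -/
theorem geomPrimaryTorsion_fixed_eq_zero_of_row (hp5 : 5 ≤ p) (hgood : V.HasGoodReductionAtPrime p)
    (hap : V.frobeniusTrace p = 0) (v : HeightOneSpectrum (𝓞 ℚ)) (hv : ((p : ℕ) : 𝓞 ℚ) ∈ v.asIdeal)
    (x : V.geomPrimaryTorsion p) (hpx : p • x = 0) (hx : ∀ d ∈ decomp v, d • x = x) : x = 0 :=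
  geomTorsion_fixed_eq_zero_of_geomPrimaryTorsion' V p v (geomTorsion_fixed_eq_zero_of_row V p hp5 hgood hap v hv) x hpx hx

end Row

/-! ## §2 The additive partner `W` (`C • W^{(p*)} = V`): (c1) and (c3) are automatic too -/

section Partner

variable [V.IsElliptic] [V.IsGloballyMinimal] (W : WeierstrassCurve ℚ) (C : VariableChange ℚ)

/-- **A common inertial `−1` for the pair** `(W, V)`, `C • W^{(p*)} = V`, at every `𝔓 ∣ p`: some `z ∈ I_𝔓` acts as `−1`
on `W[p]` AND on `V[p]` (tree `exists_mem_inertia_smul_eq_neg_of_goodSS_twist`, the even power of an inertia generator).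
[cite: Serre1972, §1.11 Prop. 12] [cite: SilvermanAEC2009, X.5 Cor. 5.4] -/
theorem exists_mem_inertia_smul_eq_neg_pair (hp5 : 5 ≤ p) (hgood : V.HasGoodReductionAtPrime p)
    (hap : V.frobeniusTrace p = 0) (hC : C • W.quadraticTwist ((-1) ^ (p / 2) * p) = V)
    {v : HeightOneSpectrum (𝓞 ℚ)} (hv : ((p : ℕ) : 𝓞 ℚ) ∈ v.asIdeal)
    {𝔓 : Ideal (absIntegers (𝓞 ℚ) ℚ)} (h𝔓 : 𝔓 ∈ v.primesAbove) :
    ∃ z ∈ 𝔓.inertia (absoluteGaloisGroup ℚ),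
      (∀ P : geomTorsion W (p : ℤ), z • P = -P) ∧ ∀ P : geomTorsion V (p : ℤ), z • P = -P :=
  exists_mem_inertia_smul_eq_neg_of_goodSS_twist (V := W) (p := p) (by omega) (Additive.pStar_ne_zero p) V ⟨C, hC⟩
    (goodSS_of_row V p hgood hap) hv h𝔓

/-- **`#ρ̄_{W,p}(Γ_ℚ) = #ρ̄_{V,p}(Γ_ℚ)`** for the pair `(W, V)`: the signed twisting isomorphism `t : W[p] ≃+ V[p]` (tree
`exists_torsion_addEquiv_signed_of_model_twist`) and the common inertial `−1` transport the image (tree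
`card_map_galoisRepTorsion_eq_of_signed_addEquiv` at `H = ⊤`). [cite: SilvermanAEC2009, X.5 Cor. 5.4] -/
theorem card_range_galoisRepTorsion_partner_eq (hp5 : 5 ≤ p) (hgood : V.HasGoodReductionAtPrime p)
    (hap : V.frobeniusTrace p = 0) (hC : C • W.quadraticTwist ((-1) ^ (p / 2) * p) = V) :
    Nat.card (galoisRepTorsion W p).range = Nat.card (galoisRepTorsion V p).range := by
  obtain ⟨z, -, hzW, hzV⟩ := exists_mem_inertia_smul_eq_neg_pair V p W C hp5 hgood hap hC
    (natCast_mem_asIdeal_iff_eq_primesEquiv_symm _ hp.out |>.mpr rfl)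
    (adicCompletionPrime_mem_primesAbove ℚ (primesEquiv.symm ⟨p, hp.out⟩))
  obtain ⟨t, ht⟩ := exists_torsion_addEquiv_signed_of_model_twist W p V (Additive.pStar_ne_zero p) ⟨C, hC⟩
  rw [MonoidHom.range_eq_map, MonoidHom.range_eq_map]
  exact card_map_galoisRepTorsion_eq_of_signed_addEquiv ⊤ t ht (Subgroup.mem_top z) hzW hzV

/-- **(c1) on the partner**: `p ∤ #Gal(ℚ(W[p])/ℚ)` (`#Gal(ℚ(W[p])/ℚ) = #ρ̄_W(Γ) = #ρ̄_V(Γ) = #Gal(ℚ(V[p])/ℚ)`, and (c1) on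
the row). [cite: Serre1972, §2.4 Prop. 15] [cite: SilvermanAEC2009, X.5 Cor. 5.4] -/
theorem not_dvd_card_aut_divisionField_partner [W.IsElliptic] [NeZero p] (hp5 : 5 ≤ p)
    (hgood : V.HasGoodReductionAtPrime p) (hap : V.frobeniusTrace p = 0)
    (hns : ¬ ∀ m : ℕ, V.HasSurjectiveModNGaloisRep (p ^ m : ℕ)) (hC : C • W.quadraticTwist ((-1) ^ (p / 2) * p) = V) :
    ¬ p ∣ Nat.card (W.divisionField p ≃ₐ[ℚ] W.divisionField p) := by
  rw [SmallImageDickson.natCard_aut_divisionField_eq W p, card_range_galoisRepTorsion_partner_eq V p W C hp5 hgood hap hC,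
    ← SmallImageDickson.natCard_aut_divisionField_eq V p]
  exact not_dvd_card_aut_divisionField_of_row V p hp5 hgood hap hns

/-- **(c3) on the partner, torsion currency**: at every place `v ∋ p`, no non-zero point of `W[p]` is fixed by `D_v`.
[cite: Serre1972, §1.11 Prop. 12] [cite: SilvermanAEC2009, X.5 Cor. 5.4] -/
theorem geomTorsion_fixed_eq_zero_partner (hp5 : 5 ≤ p) (hgood : V.HasGoodReductionAtPrime p)
    (hap : V.frobeniusTrace p = 0) (hC : C • W.quadraticTwist ((-1) ^ (p / 2) * p) = V)
    (v : HeightOneSpectrum (𝓞 ℚ)) (hv : ((p : ℕ) : 𝓞 ℚ) ∈ v.asIdeal)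
    (x : geomTorsion W (p : ℤ)) (hx : ∀ d ∈ decomp v, d • x = x) : x = 0 := by
  obtain ⟨z, hz, hzW, -⟩ := exists_mem_inertia_smul_eq_neg_pair V p W C hp5 hgood hap hC hv
    (adicCompletionPrime_mem_primesAbove ℚ v)
  exact geomTorsion_fixed_eq_zero_of_smul_eq_neg W p (by omega) v hz hzW x hx

/-- **(c3) on the partner, `E[p^∞]`-currency.** [cite: Serre1972, §1.11 Prop. 12] [cite: SilvermanAEC2009, X.5 Cor. 5.4] -/
theorem geomPrimaryTorsion_fixed_eq_zero_partner (hp5 : 5 ≤ p) (hgood : V.HasGoodReductionAtPrime p)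
    (hap : V.frobeniusTrace p = 0) (hC : C • W.quadraticTwist ((-1) ^ (p / 2) * p) = V)
    (v : HeightOneSpectrum (𝓞 ℚ)) (hv : ((p : ℕ) : 𝓞 ℚ) ∈ v.asIdeal)
    (x : W.geomPrimaryTorsion p) (hpx : p • x = 0) (hx : ∀ d ∈ decomp v, d • x = x) : x = 0 :=
  geomTorsion_fixed_eq_zero_of_geomPrimaryTorsion' W p v
    (geomTorsion_fixed_eq_zero_partner V p W C hp5 hgood hap hC v hv) x hpx hx

/-- **`W[p]` is irreducible** for the partner (tree `hasIrreducibleModPGaloisRep_iff_of_smul_eq_quadraticTwist` + §1).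
[cite: SilvermanAEC2009, X.5 Cor. 5.4] [cite: Serre1972, §1.11 Prop. 12] -/
theorem irreducible_partner [W.IsElliptic] (hp5 : 5 ≤ p) (hgood : V.HasGoodReductionAtPrime p)
    (hap : V.frobeniusTrace p = 0) (hC : C • W.quadraticTwist ((-1) ^ (p / 2) * p) = V) :
    W.HasIrreducibleModPGaloisRep p := by
  haveI : NeZero (2 : ℚ) := ⟨two_ne_zero⟩
  exact (W.hasIrreducibleModPGaloisRep_iff_of_smul_eq_quadraticTwist V (Additive.pStar_ne_zero p)
    (show C⁻¹ • V = _ by rw [← hC, inv_smul_smul]) p).mp (irreducible_of_row V p hp5 hgood hap)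

end Partner

/-! ## §3 Statement (A) on the row and on the partner from ONE class-group datum (door L6, no named fact) -/

section ConjA

/-- **(A) from `p ∤ h(ℚ(P))` for ONE non-zero `p`-torsion point — door L6, NO named fact** (the fact-free twin of conjA-anchor
g8's `DeoRaySujatha2023.thm39_of_homTrivial_of_classNumber_stabilizerField`, whose binder `h` = Deo–Ray–Sujatha Thm. 3.9 (b) is here
replaced by conjA-anchor g17's kernel theorem `CoatesSujatha2005.conjA_of_eigenHom_subfield`): for `W/ℚ` elliptic, `p` odd, `W[p]`
irreducible, (c1) `p ∤ #Gal(ℚ(W[p])/ℚ)`, some `P ∈ W[p] ∖ 0` with `p ∤ h(ℚ(P))` (`ℚ(P)` = the fixed field, inside `ℚ(W[p])`, of the image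
of the stabiliser of `P`), and (c3) at the places above `p` in the `E[p^∞]`-currency, statement (A) holds for `W` at `p` over the
cyclotomic `ℤ_p`-extension (`∃ γ D, D.X` finitely generated over `ℤ_p`). The eigen-test of the door is discharged trivially: every additive
`Cl(𝓞_{ℚ(P)}) → ZMod p` vanishes when `p ∤ h(ℚ(P))`. [cite: CoatesSujatha2005, §3 Thm. 3.4 and Lemma 3.8]
[cite: DeoRaySujatha2023, §3 Thm. 3.8 (c2) (arXiv:2202.09937 p. 9)] [cite: NeukirchANT1999, Ch. III §1 Prop. (1.6) (iv)] -/
theorem conjA_of_not_dvd_classNumber_stabilizerField (W : WeierstrassCurve ℚ) [W.IsElliptic] [NeZero p] (hp2 : p ≠ 2)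
    (hirr : W.HasIrreducibleModPGaloisRep p)
    (hG : ¬ p ∣ Nat.card (W.divisionField p ≃ₐ[ℚ] W.divisionField p))
    (hP : haveI : NumberField (W.divisionField p) := NumberField.mk
      ∃ P : geomTorsion W (p : ℤ), P ≠ 0 ∧
        ¬ p ∣ NumberField.classNumber (IntermediateField.fixedField
          ((MulAction.stabilizer (absoluteGaloisGroup ℚ) P).map (absRestrictNormalHom (W.divisionField p)))))
    {κ : ZpExtension ℚ p} (hκ : κ.IsCyclotomic)
    (hc3 : ∀ v : HeightOneSpectrum (𝓞 ℚ), ((p : ℕ) : 𝓞 ℚ) ∈ v.asIdeal →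
      ∀ x : W.geomPrimaryTorsion p, p • x = 0 → (∀ d ∈ decomp v, d • x = x) → x = 0) :
    ∃ (γ : absoluteGaloisGroup ℚ) (D : W.FineSelmerDualData κ γ),
      Module.Finite ℤ_[p] (RestrictScalars ℤ_[p] (IwasawaAlgebra p) D.X) := by
  haveI : NumberField (W.divisionField p) := NumberField.mk
  obtain ⟨P, hP0, hK⟩ := hP
  set K : IntermediateField ℚ (W.divisionField p) := IntermediateField.fixedField
    ((MulAction.stabilizer (absoluteGaloisGroup ℚ) P).map (absRestrictNormalHom (W.divisionField p))) with hKdef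
  refine conjA_of_eigenHom_subfield W hp2 hirr hG K P hP0 ?_ ?_ hκ hc3
  · -- `Γ_{ℚ(P)}` fixes `P`
    intro τ hτ
    have hmem : absRestrictNormalHom (W.divisionField p) τ ∈
        (MulAction.stabilizer (absoluteGaloisGroup ℚ) P).map (absRestrictNormalHom (W.divisionField p)) := by
      rw [← IntermediateField.fixingSubgroup_fixedField
        ((MulAction.stabilizer (absoluteGaloisGroup ℚ) P).map (absRestrictNormalHom (W.divisionField p))),
        IntermediateField.mem_fixingSubgroup_iff]
      intro x hx
      exact hτ ⟨x, hx⟩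
    obtain ⟨τ₀, hτ₀, hres⟩ := Subgroup.mem_map.mp hmem
    have h1 : absRestrictNormalHom (W.divisionField p) (τ₀⁻¹ * τ) = 1 := by rw [map_mul, map_inv, hres, inv_mul_cancel]
    have h2 := (W.absRestrictNormalHom_divisionField_eq_one_iff p (τ₀⁻¹ * τ)).mp h1 P
    rw [mul_smul, inv_smul_eq_iff] at h2
    rw [h2]; exact hτ₀
  · -- the eigen-test is empty: `p ∤ #Cl(𝓞_{ℚ(P)})`
    intro μ _
    refine addMonoidHom_zmod_eq_zero_of_not_dvd_card p ?_ μ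
    rwa [Nat.card_eq_fintype_card]

variable [V.IsElliptic] [V.IsGloballyMinimal]

/-- **(A) on a ROW of crux 19606 from the isotypic datum (c2*)₀** `Hom_{Γ_ℚ}(Cl(𝓞_{ℚ(V[p])}), V[p]) = 0` — door L6 with (c1), (c3)
discharged by §1; no named fact. [cite: CoatesSujatha2005, §3 Thm. 3.4, Lemma 3.8 and Cor. 3.6]
[cite: DeoRaySujatha2023, §3 Thm. 3.8 hypotheses (c1)–(c3) (arXiv:2202.09937 p. 9)] -/
theorem conjA_row_of_homTrivial [NeZero p] (hp5 : 5 ≤ p) (hgood : V.HasGoodReductionAtPrime p)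
    (hap : V.frobeniusTrace p = 0) (hns : ¬ ∀ m : ℕ, V.HasSurjectiveModNGaloisRep (p ^ m : ℕ))
    (h0 : ∀ μ : Additive (ClassGroup (𝓞 (V.divisionField p))) →+ geomTorsion V (p : ℤ),
      (∀ (τ : absoluteGaloisGroup ℚ) (c : ClassGroup (𝓞 (V.divisionField p))),
        μ (Additive.ofMul (ClassGroup.mulEquiv
          (AmbiguousClass.intAut (absRestrictNormalHom (V.divisionField p) τ)) c)) = τ • μ (Additive.ofMul c)) → μ = 0)
    (κ : ZpExtension ℚ p) (hκ : κ.IsCyclotomic) :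
    ∃ (γ : absoluteGaloisGroup ℚ) (D : V.FineSelmerDualData κ γ),
      Module.Finite ℤ_[p] (RestrictScalars ℤ_[p] (IwasawaAlgebra p) D.X) := by
  haveI : NumberField (V.divisionField p) := NumberField.mk
  exact conjA_of_homTrivial_divisionField V (by omega) (not_dvd_card_aut_divisionField_of_row V p hp5 hgood hap hns)
    hκ h0 (fun v hv x hx => geomTorsion_fixed_eq_zero_of_row V p hp5 hgood hap v hv x hx)

/-- **(A) on a ROW of crux 19606 from `p ∤ #Cl(𝓞_{ℚ(V[p])})`** — no named fact. [cite: CoatesSujatha2005, §3 Thm. 3.4 and Lemma 3.8]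
[cite: DeoRaySujatha2023, §3 Thm. 3.9 (b) (arXiv:2202.09937 p. 10)] -/
theorem conjA_row_of_not_dvd_card_classGroup [NeZero p] (hp5 : 5 ≤ p) (hgood : V.HasGoodReductionAtPrime p)
    (hap : V.frobeniusTrace p = 0) (hns : ¬ ∀ m : ℕ, V.HasSurjectiveModNGaloisRep (p ^ m : ℕ))
    (hh : ¬ p ∣ Nat.card (ClassGroup (𝓞 (V.divisionField p)))) (κ : ZpExtension ℚ p) (hκ : κ.IsCyclotomic) :
    ∃ (γ : absoluteGaloisGroup ℚ) (D : V.FineSelmerDualData κ γ),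
      Module.Finite ℤ_[p] (RestrictScalars ℤ_[p] (IwasawaAlgebra p) D.X) := by
  haveI : NumberField (V.divisionField p) := NumberField.mk
  exact conjA_of_not_dvd_card_classGroup V (by omega) (not_dvd_card_aut_divisionField_of_row V p hp5 hgood hap hns)
    hh hκ (fun v hv x hpx hx => geomPrimaryTorsion_fixed_eq_zero_of_row V p hp5 hgood hap v hv x hpx hx)

/-- **(A) on a ROW of crux 19606 from `p ∤ h(ℚ(P))` for one `P ∈ V[p] ∖ 0`** (`[ℚ(P):ℚ] = p² − 1` on a row) — no named fact.
[cite: CoatesSujatha2005, §3 Thm. 3.4 and Lemma 3.8] [cite: DeoRaySujatha2023, §3 Thm. 3.8 (c2) (arXiv:2202.09937 p. 9)] -/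
theorem conjA_row_of_not_dvd_classNumber_stabilizerField [NeZero p] (hp5 : 5 ≤ p) (hgood : V.HasGoodReductionAtPrime p)
    (hap : V.frobeniusTrace p = 0) (hns : ¬ ∀ m : ℕ, V.HasSurjectiveModNGaloisRep (p ^ m : ℕ))
    (hP : haveI : NumberField (V.divisionField p) := NumberField.mk
      ∃ P : geomTorsion V (p : ℤ), P ≠ 0 ∧
        ¬ p ∣ NumberField.classNumber (IntermediateField.fixedField
          ((MulAction.stabilizer (absoluteGaloisGroup ℚ) P).map (absRestrictNormalHom (V.divisionField p)))))
    (κ : ZpExtension ℚ p) (hκ : κ.IsCyclotomic) :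
    ∃ (γ : absoluteGaloisGroup ℚ) (D : V.FineSelmerDualData κ γ),
      Module.Finite ℤ_[p] (RestrictScalars ℤ_[p] (IwasawaAlgebra p) D.X) :=
  conjA_of_not_dvd_classNumber_stabilizerField p V (by omega) (irreducible_of_row V p hp5 hgood hap)
    (not_dvd_card_aut_divisionField_of_row V p hp5 hgood hap hns) hP hκ
    (fun v hv x hpx hx => geomPrimaryTorsion_fixed_eq_zero_of_row V p hp5 hgood hap v hv x hpx hx)

variable (W : WeierstrassCurve ℚ) [W.IsElliptic] (C : VariableChange ℚ)

/-- **(A) on the PARTNER `W` of a row of crux 19606 (`C • W^{(p*)} = V`) from the isotypic datum (c2*)₀**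
`Hom_{Γ_ℚ}(Cl(𝓞_{ℚ(W[p])}), W[p]) = 0` — door L6 with (c1), (c3) discharged by §2; no named fact. This is the conclusion of v7's
`stub_conjA_partners_cm` (and of v5's `stub_conjA_partners`) AT THE ROW. [cite: CoatesSujatha2005, §3 Thm. 3.4, Lemma 3.8 and Cor. 3.6]
[cite: DeoRaySujatha2023, §3 Thm. 3.8 hypotheses (c1)–(c3) (arXiv:2202.09937 p. 9)] -/
theorem conjA_partner_of_homTrivial [NeZero p] (hp5 : 5 ≤ p) (hC : C • W.quadraticTwist ((-1) ^ (p / 2) * p) = V)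
    (hgood : V.HasGoodReductionAtPrime p) (hap : V.frobeniusTrace p = 0)
    (hns : ¬ ∀ m : ℕ, V.HasSurjectiveModNGaloisRep (p ^ m : ℕ))
    (h0 : ∀ μ : Additive (ClassGroup (𝓞 (W.divisionField p))) →+ geomTorsion W (p : ℤ),
      (∀ (τ : absoluteGaloisGroup ℚ) (c : ClassGroup (𝓞 (W.divisionField p))),
        μ (Additive.ofMul (ClassGroup.mulEquiv
          (AmbiguousClass.intAut (absRestrictNormalHom (W.divisionField p) τ)) c)) = τ • μ (Additive.ofMul c)) → μ = 0)
    (κ : ZpExtension ℚ p) (hκ : κ.IsCyclotomic) :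
    ∃ (γ : absoluteGaloisGroup ℚ) (D : W.FineSelmerDualData κ γ),
      Module.Finite ℤ_[p] (RestrictScalars ℤ_[p] (IwasawaAlgebra p) D.X) := by
  haveI : NumberField (W.divisionField p) := NumberField.mk
  exact conjA_of_homTrivial_divisionField W (by omega)
    (not_dvd_card_aut_divisionField_partner V p W C hp5 hgood hap hns hC) hκ h0
    (fun v hv x hx => geomTorsion_fixed_eq_zero_partner V p W C hp5 hgood hap hC v hv x hx)

/-- **(A) on the PARTNER `W` from `p ∤ #Cl(𝓞_{ℚ(W[p])})`** — no named fact. [cite: CoatesSujatha2005, §3 Thm. 3.4 and Lemma 3.8]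
[cite: DeoRaySujatha2023, §3 Thm. 3.9 (b) (arXiv:2202.09937 p. 10)] -/
theorem conjA_partner_of_not_dvd_card_classGroup [NeZero p] (hp5 : 5 ≤ p)
    (hC : C • W.quadraticTwist ((-1) ^ (p / 2) * p) = V) (hgood : V.HasGoodReductionAtPrime p)
    (hap : V.frobeniusTrace p = 0) (hns : ¬ ∀ m : ℕ, V.HasSurjectiveModNGaloisRep (p ^ m : ℕ))
    (hh : ¬ p ∣ Nat.card (ClassGroup (𝓞 (W.divisionField p)))) (κ : ZpExtension ℚ p) (hκ : κ.IsCyclotomic) :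
    ∃ (γ : absoluteGaloisGroup ℚ) (D : W.FineSelmerDualData κ γ),
      Module.Finite ℤ_[p] (RestrictScalars ℤ_[p] (IwasawaAlgebra p) D.X) := by
  haveI : NumberField (W.divisionField p) := NumberField.mk
  exact conjA_of_not_dvd_card_classGroup W (by omega)
    (not_dvd_card_aut_divisionField_partner V p W C hp5 hgood hap hns hC) hh hκ
    (fun v hv x hpx hx => geomPrimaryTorsion_fixed_eq_zero_partner V p W C hp5 hgood hap hC v hv x hpx hx)

/-- **(A) on the PARTNER `W` from `p ∤ h(ℚ(P))` for one `P ∈ W[p] ∖ 0`** (`[ℚ(P):ℚ] = p² − 1`: `24` at `p = 5`, `48` at `p = 7`)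
— no named fact; the per-row class-number certificate shape of the conjA-anchor census, now available on every K8 partner with
no displayed (c1)/(c3). [cite: CoatesSujatha2005, §3 Thm. 3.4 and Lemma 3.8] [cite: DeoRaySujatha2023, §3 Thm. 3.8 (c2) (arXiv:2202.09937 p. 9)] -/
theorem conjA_partner_of_not_dvd_classNumber_stabilizerField [NeZero p] (hp5 : 5 ≤ p)
    (hC : C • W.quadraticTwist ((-1) ^ (p / 2) * p) = V) (hgood : V.HasGoodReductionAtPrime p)
    (hap : V.frobeniusTrace p = 0) (hns : ¬ ∀ m : ℕ, V.HasSurjectiveModNGaloisRep (p ^ m : ℕ))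
    (hP : haveI : NumberField (W.divisionField p) := NumberField.mk
      ∃ P : geomTorsion W (p : ℤ), P ≠ 0 ∧
        ¬ p ∣ NumberField.classNumber (IntermediateField.fixedField
          ((MulAction.stabilizer (absoluteGaloisGroup ℚ) P).map (absRestrictNormalHom (W.divisionField p)))))
    (κ : ZpExtension ℚ p) (hκ : κ.IsCyclotomic) :
    ∃ (γ : absoluteGaloisGroup ℚ) (D : W.FineSelmerDualData κ γ),
      Module.Finite ℤ_[p] (RestrictScalars ℤ_[p] (IwasawaAlgebra p) D.X) :=
  conjA_of_not_dvd_classNumber_stabilizerField p W (by omega) (irreducible_partner V p W C hp5 hgood hap hC)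
    (not_dvd_card_aut_divisionField_partner V p W C hp5 hgood hap hns hC) hP hκ
    (fun v hv x hpx hx => geomPrimaryTorsion_fixed_eq_zero_partner V p W C hp5 hgood hap hC v hv x hpx hx)

end ConjA

end Summit.BirchSwinnertonDyer.BirchSwinnertonDyer.Theorems.EtaConjADoor

end
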